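import Mathlib.Analysis.Subadditive
import Mathlib.Analysis.SpecialFunctions.Pow.Real
import Literature.Barriers.MatrixMultiplication.UniversalMethodBarrierCor28
import Literature.Computability.AlgebraicComplexity.CoppersmithWinograd1990Proofs
import HarnessLib

/-!
# The asymptotic rank as a limit: `R̃(T) = lim_n R(T^{⊗n})^{1/n}` (Fekete) — proved

Topic `Literature/Computability/AlgebraicComplexity`.  Alman–Duan–Vassilevska Williams–Xu–Xu–Zhou,
*More asymmetry yields faster matrix multiplication* (SODA 2025, arXiv:2404.16349), §3.2:

> The third item above implies that for all `m`, `R(T^{⊗n}) ≤ R(T)^m` … Due to Fekete's lemma,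
> the following asymptotic rank `R̃(T)` is well-defined for every tensor `T`:
> `R̃(T) := lim_{n→∞} (R(T^{⊗n}))^{1/n}`.  The asymptotic rank is upper bounded by
> `R(T^{⊗m})^{1/m}` for any fixed integer `m > 0`.

The tree DEFINES `asymptoticRank t = ⨅_{N} R(t^{⊗(N+1)})^{1/(N+1)}` (`AsymptoticSpectrum.lean`,
following Christandl–Vrana–Zuiddam: "the limit exists and equals the infimum by Fekete's lemma"),
and several files are organised so as to avoid the limit.  This file PROVES that the printed
definition agrees with the tree's: the sequence `R(t^{⊗n})^{1/n}` converges to `asymptoticRank t`.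

* sub-multiplicativity along powers, `R(t^{⊗(m+n)}) ≤ R(t^{⊗m}) R(t^{⊗n})`, is the tree's
  `tensorRank_kroneckerPow_add_le` (`CoppersmithWinograd1990Proofs.lean`; Bläser 2013, Lemma 5.8),
  i.e. `n ↦ log R(t^{⊗n})` is subadditive;
* `advxxz2025_asymptoticRank_tendsto` — **`R(t^{⊗n})^{1/n} → R̃(t)`** (Mathlib's Fekete lemma
  `Subadditive.tendsto_lim` for `log R(t^{⊗n})`, `t ≠ 0`; the zero tensor separately), together with
  the printed remark "`R̃` is upper bounded by `R(T^{⊗m})^{1/m}` for any fixed `m > 0`" being the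
  tree's `Literature.Barriers.MatrixMultiplication.asymptoticRank_le_rpow` (immediate for an infimum).

Everything is proved; no definitions, no named facts.

## References

* J. Alman, R. Duan, V. Vassilevska Williams, Y. Xu, Z. Xu, R. Zhou, *More asymmetry yields faster
  matrix multiplication*, SODA 2025, arXiv:2404.16349 (held: `paper:arxiv-2404.16349`, chunk p0008),
  §3.2 (asymptotic rank). [AlmanDuanVassilevskaWilliamsXuXuZhou2025]
* M. Bläser, *Fast Matrix Multiplication*, Theory of Computing Graduate Surveys 5 (2013), Lemma 5.8,
  §9.2. [Blaser2013]
* M. Christandl, P. Vrana, J. Zuiddam, *Universal points in the asymptotic spectrum of tensors*,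
  J. Amer. Math. Soc. 36 (2023), §1.1. [ChristandlVranaZuiddam2023]
-/

noncomputable section

open Filter Topology

namespace Literature.Computability.AlgebraicComplexity

open Literature.Barriers.MatrixMultiplication (kroneckerPow_ne_zero one_le_tensorRank_of_ne_zero
  asymptoticRank_le_rpow)

universe u

variable {K : Type u} [Field K] {ι κ μ : Type*} [Fintype ι] [Fintype κ] [Fintype μ]

omit [Fintype ι] [Fintype κ] [Fintype μ] in
/-- The Kronecker powers `N ≥ 1` of the zero tensor vanish. [folklore] -/
theorem kroneckerPow_zero_tensor_of_pos {N : ℕ} (hN : 0 < N) :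
    kroneckerPow (0 : ι → κ → μ → K) N = 0 := by
  funext a b c
  simp only [kroneckerPow_apply, Pi.zero_apply, Finset.prod_const, Finset.card_univ,
    Fintype.card_fin]
  exact zero_pow (by omega)

/-- `R̃(0) = 0`. [folklore] -/
theorem asymptoticRank_zero : asymptoticRank (0 : ι → κ → μ → K) = 0 := by
  unfold asymptoticRank
  have h : ∀ N : ℕ, ((tensorRank (kroneckerPow (0 : ι → κ → μ → K) (N + 1)) : ℝ) ^
      ((N : ℝ) + 1)⁻¹) = 0 := fun N => by
    rw [kroneckerPow_zero_tensor_of_pos (Nat.succ_pos N), tensorRank_zero, Nat.cast_zero,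
      Real.zero_rpow (inv_ne_zero (by positivity))]
  simp_rw [h]
  exact ciInf_const

/-- **ADVXXZ §3.2 / Fekete: `R̃(T) = lim_{n→∞} R(T^{⊗n})^{1/n}`** — the sequence `R(t^{⊗n})^{1/n}`
converges to the tree's `asymptoticRank t = inf_{n ≥ 1} R(t^{⊗n})^{1/n}`.  For `t ≠ 0` all powers
have rank `≥ 1`, `u(n) = log R(t^{⊗n})` is subadditive (`tensorRank_kroneckerPow_add_le`) and
bounded below by `0`, so `u(n)/n` converges (Fekete, Mathlib's `Subadditive.tendsto_lim`) to a limit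
`ℓ` with `ℓ ≤ u(n)/n` for all `n ≥ 1`; `exp ℓ ≤ R̃` by the infimum and `R̃ ≤ exp ℓ` by passing to
the limit in `R̃ ≤ R(t^{⊗n})^{1/n}`.  For `t = 0` both sides vanish from `n = 1` on.
[cite: AlmanDuanVassilevskaWilliamsXuXuZhou2025, §3.2] -/
theorem advxxz2025_asymptoticRank_tendsto (t : ι → κ → μ → K) :
    Tendsto (fun n : ℕ => (tensorRank (kroneckerPow t n) : ℝ) ^ ((n : ℝ)⁻¹)) atTop
      (𝓝 (asymptoticRank t)) := by
  by_cases ht : t = 0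
  · -- the zero tensor
    subst ht
    rw [asymptoticRank_zero]
    refine tendsto_const_nhds.congr' ?_
    filter_upwards [eventually_ge_atTop 1] with n hn
    rw [kroneckerPow_zero_tensor_of_pos (by omega), tensorRank_zero, Nat.cast_zero,
      Real.zero_rpow (inv_ne_zero (by exact_mod_cast (by omega : n ≠ 0)))]
  · -- `u(n) = log R(t^{⊗n})` is subadditive and `≥ 0`
    have hR1 : ∀ n, (1 : ℝ) ≤ tensorRank (kroneckerPow t n) := fun n => by
      exact_mod_cast one_le_tensorRank_of_ne_zero (kroneckerPow_ne_zero ht n)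
    have hR0 : ∀ n, (0 : ℝ) < tensorRank (kroneckerPow t n) := fun n => by linarith [hR1 n]
    set u : ℕ → ℝ := fun n => Real.log (tensorRank (kroneckerPow t n)) with hu
    have hu0 : ∀ n, 0 ≤ u n := fun n => Real.log_nonneg (hR1 n)
    have hsub : Subadditive u := fun m n => by
      simp only [hu]
      rw [← Real.log_mul (hR0 m).ne' (hR0 n).ne']
      exact Real.log_le_log (hR0 (m + n)) (by exact_mod_cast tensorRank_kroneckerPow_add_le t m n)
    have hbdd : BddBelow (Set.range fun n => u n / n) :=
      ⟨0, by rintro _ ⟨n, rfl⟩; exact div_nonneg (hu0 n) (Nat.cast_nonneg _)⟩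
    have hlim := hsub.tendsto_lim hbdd
    set ℓ := hsub.lim with hℓ
    -- the sequence is `exp (u n / n)`
    have heq : (fun n : ℕ => (tensorRank (kroneckerPow t n) : ℝ) ^ ((n : ℝ)⁻¹)) =
        fun n => Real.exp (u n / n) := by
      funext n
      rw [Real.rpow_def_of_pos (hR0 n), hu, div_eq_mul_inv]
    have hexp : Tendsto (fun n : ℕ => (tensorRank (kroneckerPow t n) : ℝ) ^ ((n : ℝ)⁻¹)) atTop
        (𝓝 (Real.exp ℓ)) := by
      rw [heq]
      exact (Real.continuous_exp.tendsto ℓ).comp hlim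
    -- identification of the limit with the infimum
    have h1 : Real.exp ℓ ≤ asymptoticRank t := by
      unfold asymptoticRank
      refine le_ciInf fun N => ?_
      have hle : ℓ ≤ u (N + 1) / (N + 1 : ℕ) := hsub.lim_le_div hbdd (Nat.succ_ne_zero N)
      have e : ((tensorRank (kroneckerPow t (N + 1)) : ℝ) ^ ((N : ℝ) + 1)⁻¹) =
          Real.exp (u (N + 1) / (N + 1 : ℕ)) := by
        rw [Real.rpow_def_of_pos (hR0 (N + 1)), hu, div_eq_mul_inv]
        push_cast
        rfl
      rw [e]
      exact Real.exp_le_exp.2 hle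
    have h2 : asymptoticRank t ≤ Real.exp ℓ :=
      ge_of_tendsto hexp (by
        filter_upwards [eventually_gt_atTop 0] with n hn
        exact asymptoticRank_le_rpow t hn)
    have h3 : asymptoticRank t = Real.exp ℓ := le_antisymm h2 h1
    rw [h3]
    exact hexp

end Literature.Computability.AlgebraicComplexity

end
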